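import Literature.AlgebraicGeometry.Frobenioids.PerfFactorialWeakCoprime
import Literature.AlgebraicGeometry.Frobenioids.PerfectionDivisorial
import Literature.AlgebraicGeometry.Frobenioids.PrimaryStepsPrimeClasses
import Literature.AlgebraicGeometry.Frobenioids.PrimesEquivalence

/-!
# Frobenioids I, Prop. 4.1 (ii) / Def. 2.4 (i): primary elements and common primes, order-theoretically —
# for WEAKLY perf-factorial monoids (the monoid inputs of [FrdI] Thm. 4.2 (i))

Mochizuki, *The geometry of Frobenioids I*, Kyushu J. Math. **62** (2008), Prop. 4.1 (ii) p. 76 ("the necessity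
of this condition follows immediately from the structure of the `Φ(A)_𝔭` [Definition 2.4, (i), (b)]"; sufficiency
"by comparing the primary factorizations"), Def. 2.4 (i)(b)(c) p. 47 [cite: MochizukiFrdI2008, Prop. 4.1 (ii) p.76].

abc-iut cell, F-L2d2-1 / F-L2d2-2 repair chain (seat abc-iut-L2-d2).  The tree's proof of [FrdI] Thm. 4.2 (i)
("equivalences of Frobenioids preserve primary steps"; `Thm42PrimaryStepsPropagation.lean` … `Thm42OfPreStepsGeneral.lean`,
abc-iut-L1) consumes the printed perf-factoriality of the divisor monoids ONLY through five monoid lemmas —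
`IsPerfFactorial.exists_common_dvd_of_isPrimary_mul`, `.exists_common_prime_iff`,
`.isPrimary_mul_iff_exists_common_prime`, `.dvd_total_of_dvd_of_isPrimary`, `.isPrimary_of_dvd_total` /
`.isPrimary_iff_dvd_total`.  At the tempered coverings of [EtTh] §3 with infinitely many special-fibre components
(`Ÿ`, `Z_∞`) the divisor monoids are only WEAKLY perf-factorial (cell findings F-L2d2-1, F-L2d2-2), and the
residual named input of the cell's Cor. 3.8 (iii) discharge over the weak data (`cor38_iii_ofRlfZWeak…`, binders
`hprim`/`hprim'`) is exactly Thm. 4.2 (i) for such monoids.  THIS FILE supplies the five lemmas for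
`IsPerfFactorialWeak` — verbatim ports of the abc-iut-L1 proofs, which use only clauses (a)(b)(c) and the
restriction clause (d_res) (`exists_split`), all available in abc-iut-L1-t2's weak API
(`PerfFactorialWeak(Coprime).lean`) — so that the Frobenioid-level chain can be re-typed over the weak notion by
replacing the hypothesis `Objectwise IsPerfFactorial` with `Objectwise IsPerfFactorialWeak` (printed-perf-factorial
monoids are covered via `IsPerfFactorial.weak`).  Theorems only.  HONEST FRAMING: classical monoid algebra; nothing
here bears on [IUTchIII] Cor. 3.12.
-/

namespace Literature.AlgebraicGeometry.Frobenioids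

open Function

universe w

namespace IsPerfFactorialWeak

variable {M : Type w} [CommMonoid M]

/-- A non-trivial element of `M^pf` has a factorization that is non-trivial at some prime (clause (c):
injectivity of the factorization homomorphism), weak hypothesis. [cite: MochizukiFrdI2008, Def. 2.4(i) p.47] -/
private theorem exists_prime_factorMap_ne_one_w (h : IsPerfFactorialWeak M) {ξ : Perfection M} (hξ : ξ ≠ 1) :
    ∃ 𝔮 : Primes (Perfection M), factorMap M ξ 𝔮 ≠ 1 := by
  by_contra hall
  push Not at hall
  exact hξ (h.factorMap_injective ((funext hall).trans h.factorMap_one.symm))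

/-- **Prop. 4.1 (ii), necessity in the language of monoids, weak hypothesis**: if `x` and `x·y` are primary and
`x·y = x'·y'` with `x' ≠ 1`, then some `x'' ≠ 1` divides both `x` and `x'` (`x, x'` lie in the prime of `x·y`,
inside whose `M_𝔭` divisibility is total — clause (b)). [cite: MochizukiFrdI2008, Prop. 4.1 (ii) p.76] -/
theorem exists_common_dvd_of_isPrimary_mul (h : IsPerfFactorialWeak M) {x y x' y' : M}
    (hx : IsPrimary x) (hxy : IsPrimary (x * y)) (hx' : x' ≠ 1) (he : x * y = x' * y') :
    ∃ x'' : M, x'' ≠ 1 ∧ x'' ∣ x ∧ x'' ∣ x' := by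
  let 𝔭 : Primes M := Quotient.mk (primarySetoid M) ⟨x * y, hxy⟩
  have hp : x * y ∈ 𝔭.carrier := mem_carrier_mk_of_isPrimary hxy
  have hxp : x ∈ 𝔭.submonoid := Submonoid.subset_closure
    (𝔭.mem_carrier_of_precsim hp hx.1 (Precsim.of_dvd (Dvd.intro _ rfl)))
  have hx'p : x' ∈ 𝔭.submonoid := Submonoid.subset_closure
    (𝔭.mem_carrier_of_precsim hp hx' (Precsim.of_dvd (Dvd.intro _ he.symm)))
  rcases h.dvd_total_of_mem_submonoid 𝔭 hxp hx'p with h1 | h1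
  · exact ⟨x, hx.1, dvd_rfl, h1⟩
  · exact ⟨x', hx', h1, dvd_rfl⟩

/-- In a weakly perf-factorial monoid (each `M_𝔭` monoprime, clause (b)), two primary elements lie in a common
prime iff they have a common non-trivial divisor. [cite: MochizukiFrdI2008, Def. 2.4(i) p.47] -/
theorem exists_common_prime_iff (h : IsPerfFactorialWeak M) {x y : M} (hx : IsPrimary x) (hy : IsPrimary y) :
    (∃ 𝔭 : Primes M, x ∈ 𝔭.carrier ∧ y ∈ 𝔭.carrier) ↔ ∃ z : M, z ≠ 1 ∧ z ∣ x ∧ z ∣ y := by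
  constructor
  · rintro ⟨𝔭, hx𝔭, hy𝔭⟩
    rcases h.dvd_total_of_mem_submonoid 𝔭 (Submonoid.subset_closure hx𝔭)
      (Submonoid.subset_closure hy𝔭) with hxy | hyx
    · exact ⟨x, hx.1, dvd_rfl, hxy⟩
    · exact ⟨y, hy.1, hyx, dvd_rfl⟩
  · rintro ⟨z, hz1, hzx, hzy⟩
    let 𝔭 : Primes M := Quotient.mk (primarySetoid M) ⟨x, hx⟩
    let 𝔮 : Primes M := Quotient.mk (primarySetoid M) ⟨y, hy⟩
    have hx𝔭 : x ∈ 𝔭.carrier := mem_carrier_mk_of_isPrimary hx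
    have hy𝔮 : y ∈ 𝔮.carrier := mem_carrier_mk_of_isPrimary hy
    have hz𝔭 : z ∈ 𝔭.carrier := 𝔭.mem_carrier_of_precsim hx𝔭 hz1 (Precsim.of_dvd hzx)
    have hz𝔮 : z ∈ 𝔮.carrier := 𝔮.mem_carrier_of_precsim hy𝔮 hz1 (Precsim.of_dvd hzy)
    exact ⟨𝔭, hx𝔭, (Primes.eq_of_mem_carrier hz𝔭 hz𝔮) ▸ hy𝔮⟩

/-- **Prop. 4.1 (ii) in the language of monoids, weak hypothesis**: the product of two primary elements is primary
iff they lie in a common prime. [cite: MochizukiFrdI2008, Prop. 4.1 (ii) p.76] -/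
theorem isPrimary_mul_iff_exists_common_prime (h : IsPerfFactorialWeak M) {x y : M}
    (hx : IsPrimary x) (hy : IsPrimary y) :
    IsPrimary (x * y) ↔ ∃ 𝔭 : Primes M, x ∈ 𝔭.carrier ∧ y ∈ 𝔭.carrier := by
  constructor
  · intro hxy
    obtain ⟨z, hz1, hzx, hzy⟩ := h.exists_common_dvd_of_isPrimary_mul hx hxy hy.1 (mul_comm x y)
    exact (h.exists_common_prime_iff hx hy).mpr ⟨z, hz1, hzx, hzy⟩
  · rintro ⟨𝔭, hx𝔭, hy𝔭⟩
    have hmem : x * y ∈ 𝔭.submonoid :=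
      mul_mem (Submonoid.subset_closure hx𝔭) (Submonoid.subset_closure hy𝔭)
    rcases (𝔭.mem_submonoid_iff' _).mp hmem with h1 | h1
    · exact absurd (h.isDivisorial.isSharp.eq_one_of_isUnit _ (IsUnit.of_mul_eq_one _ h1)) hx.1
    · exact h1.1

/-- In a weakly perf-factorial monoid, any two divisors of a primary element are comparable (they lie, together
with the element, in one monoprime `M_𝔭`; clause (b)). [cite: MochizukiFrdI2008, Def. 2.4 (i) p.47] -/
theorem dvd_total_of_dvd_of_isPrimary (h : IsPerfFactorialWeak M) {x b c : M}
    (hx : IsPrimary x) (hb : b ∣ x) (hc : c ∣ x) : b ∣ c ∨ c ∣ b := by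
  by_cases hb1 : b = 1
  · exact Or.inl (hb1 ▸ one_dvd c)
  by_cases hc1 : c = 1
  · exact Or.inr (hc1 ▸ one_dvd b)
  let 𝔭 : Primes M := Quotient.mk (primarySetoid M) ⟨x, hx⟩
  have hxp : x ∈ 𝔭.carrier := mem_carrier_mk_of_isPrimary hx
  have hbp : b ∈ 𝔭.submonoid :=
    Submonoid.subset_closure (𝔭.mem_carrier_of_precsim hxp hb1 (Precsim.of_dvd hb))
  have hcp : c ∈ 𝔭.submonoid :=
    Submonoid.subset_closure (𝔭.mem_carrier_of_precsim hxp hc1 (Precsim.of_dvd hc))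
  exact h.dvd_total_of_mem_submonoid 𝔭 hbp hcp

/-- In a PERFECT weakly perf-factorial monoid, a non-trivial element any two of whose divisors are comparable is
primary ("by comparing the primary factorizations": a non-primary `x ≠ 1` has a non-trivial `𝔮`-component and a
non-trivial `𝔮`-free part for some prime `𝔮` of its support — the restriction clause (d_res), `exists_split` — and
these two divisors of `x` are incomparable). [cite: MochizukiFrdI2008, Def. 2.4 (i) p.47] -/
theorem isPrimary_of_dvd_total (h : IsPerfFactorialWeak M) (hperf : IsPerfect M)
    {x : M} (hx : x ≠ 1) (htot : ∀ b c : M, b ∣ x → c ∣ x → b ∣ c ∨ c ∣ b) : IsPrimary x := by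
  classical
  have hM : IsSharp M := h.isDivisorial.isSharp
  have hbij := isPerfect_iff_bijective_of.mp hperf
  by_contra hnp
  have hox1 : Perfection.of M x ≠ 1 := fun e => hx (hbij.1 (by rw [e, map_one]))
  obtain ⟨𝔮, hq⟩ := h.exists_prime_factorMap_ne_one_w hox1
  obtain ⟨x₁, x₂, xx, hxs, hx₁, hx₂⟩ := h.exists_split (Perfection.of M x) 𝔮
  have hx₁q : factorMap M x₁ 𝔮 ≠ 1 := by
    rw [← h.factorMap_apply_of_split_same hxs hx₂]; exact hq
  have hx₁1 : x₁ ≠ 1 := fun e => hx₁q (by rw [e, h.factorMap_one]; rfl)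
  have hx₁c : x₁ ∈ 𝔮.carrier := h.mem_carrier_of_factorMap_eq_mulSingle xx hx₁ hx₁1
  -- the `𝔮`-free part is non-trivial, for otherwise `x` would be primary
  have hx₂1 : x₂ ≠ 1 := by
    intro e
    apply hnp
    rw [e, mul_one] at hxs
    obtain ⟨hprim, -⟩ := hx₁c
    rw [hxs] at hprim
    exact (Perfection.isPrimary_of_iff hM).mp hprim
  obtain ⟨X₁, hX₁⟩ := hbij.2 x₁
  obtain ⟨X₂, hX₂⟩ := hbij.2 x₂
  have hX₁x : X₁ ∣ x := (Perfection.of_dvd_of_iff hbij).mp (by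
    rw [hX₁, ← hxs]; exact Dvd.intro _ rfl)
  have hX₂x : X₂ ∣ x := (Perfection.of_dvd_of_iff hbij).mp (by
    rw [hX₂, ← hxs]; exact Dvd.intro_left _ rfl)
  rcases htot X₁ X₂ hX₁x hX₂x with hd | hd
  · -- `x₁ ∣ x₂` is impossible: `x₁ ∈ 𝔮`, `x₂` is `𝔮`-free
    have hd' : x₁ ∣ x₂ := by rw [← hX₁, ← hX₂]; exact map_dvd _ hd
    exact h.not_dvd_of_factorMap_apply_eq_one hx₁c hx₂ hd'
  · -- `x₂ ∣ x₁` is impossible: the support of `x₂` would lie in `{𝔮}`, where `x₂` has no coordinate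
    have hd' : x₂ ∣ x₁ := by rw [← hX₁, ← hX₂]; exact map_dvd _ hd
    apply hx₂1
    apply h.factorMap_injective
    rw [h.factorMap_one]
    funext 𝔮'
    by_cases e : 𝔮' = 𝔮
    · rw [e, hx₂]; rfl
    · by_contra hne
      have hmem : 𝔮' ∈ supp (factorMap M x₂) := hne
      have h1 := h.supp_factorMap_subset_of_dvd hd' hmem
      simp only [supp, Set.mem_setOf_eq, hx₁, pfFactorToRlfFactor_apply, Pi.mulSingle_eq_of_ne e,
        map_one, ne_eq, not_true_eq_false] at h1

/-- **Primary elements of a perfect weakly perf-factorial monoid, order-theoretically**: `x` is primary iff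
`x ≠ 1` and any two divisors of `x` are comparable (clauses (b)(c), (d_res)).
[cite: MochizukiFrdI2008, Def. 2.4 (i) p.47] -/
theorem isPrimary_iff_dvd_total (h : IsPerfFactorialWeak M) (hperf : IsPerfect M) (x : M) :
    IsPrimary x ↔ x ≠ 1 ∧ ∀ b c : M, b ∣ x → c ∣ x → b ∣ c ∨ c ∣ b :=
  ⟨fun hx => ⟨hx.1, fun _ _ hb hc => h.dvd_total_of_dvd_of_isPrimary hx hb hc⟩,
    fun hx => h.isPrimary_of_dvd_total hperf hx.1 hx.2⟩

end IsPerfFactorialWeak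

end Literature.AlgebraicGeometry.Frobenioids
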